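import Summits.ValiantsHypothesis.ValiantsHypothesis.Theorems.KPlusLogSqLawTropicalBVisitedImages

/-!
# Route «KPlusLogSqLaw», crux `TropicalB` (stmt-ValiantsHypothesis-19771) — THE VISITED-IMAGE RECURSION WITH A NODE-DEPENDENT BUDGET:
# `#St(a, a+2^k) · (B_k(a, a+2^k) + B_k(a+2^k, c)) ≤ B_{k+1}(a, c)` absorbs one split, so `n + 1 ≤ B_{⌊log₂ m⌋+1}(0, m)`

HONEST FRAMING.  Helper toward the registered stubs `stub_tropThin` / `stub_tropFat` of `Cruxes/TropicalB/Lines/birth.lean` (crux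
`Summit.ValiantsHypothesis.ValiantsHypothesis.Theses.KPlusLogSqLaw.TropicalB`, item stmt-ValiantsHypothesis-19771, route KPlusLogSqLaw,
DRAFT; cell `pub-symmetroid`, seat val-sym-trop-p1 g7, 2026-08-27; `--supports … --as helper`).  Bookkeeping only: the state-count
recursion with the per-node state counts kept separate instead of a uniform bound `T`; nothing here bounds `TropicalB`, and nothing
bears on `TropicalB` in its window, `WeakLifting`, DoorA26 / DoorA34, `MatrixDescartes` (stmt-ValiantsHypothesis-18050) or VP ≠ VNP.

WHY.  The uniform forms (`chain_le_of_states_pred`, `chain_le_of_visitedImages`: `n + 1 ≤ (mK+1)·(2V)^{⌊log₂ m⌋+1}`) charge the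
LARGEST state count at EVERY level.  The recursion actually proved is node-wise: splitting the dyadic node `[a, c)` (length in
`(2^k, 2^{k+1}]`) at `t = a + 2^k` costs the factor `#St(a, t)` = number of row images of the FIRST HALF `[a, t)` only, times the sum of
the two children's budgets.  So any budget `B : ℕ → ℕ → ℕ → ℕ` («level, left end, right end») with
`mK + 1 ≤ B 0 a c`, `B k a c ≤ B (k+1) a c` (short nodes) and `#St(a, a+2^k)·(B k a (a+2^k) + B k (a+2^k) c) ≤ B (k+1) a c` bounds the
optimal restrictions of `P`-terms on `[a, c)` (`card_optRestr_img_le_budget`), and a dominant chain of `P`-terms has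
`n + 1 ≤ B (⌊log₂ m⌋+1) 0 m` (`chain_le_budget`); with the chain's own visited images as states (`chain_le_visitedBudget`) this is the
precise currency «Σ over the levels of ONE root-to-leaf path of log₂(#visited images of the first half)» in which a visited-state
bound along a chain has to be found (cf. the reading after `chain_le_card_states_mul`, …TropicalBChainSplit, and seat memo
SHADOW-AND-WALKS-g6 §3: «TB needs Σ_levels log I = O(K + log² m)»).  [folklore: Gusfield 1980; bookkeeping of this file]
-/

set_option linter.dupNamespace false
set_option autoImplicit false

namespace Summit.ValiantsHypothesis.ValiantsHypothesis.Theorems.KPlusLogSqLaw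

open Summit.ValiantsHypothesis.ValiantsHypothesis.Theorems.MatrixDescartes.Negative
open Summit.ValiantsHypothesis.ValiantsHypothesis.Theorems.LacunarySymmetroidMatrixDescartes
open scoped BigOperators
open Finset

namespace IntervalOpt

variable {m K : ℕ} {d : Fin K → ℕ} {v ε : Fin m → Fin m → Fin K → ℤ}

/-- **State-count recursion with a node-dependent budget.**  `P` a predicate on terms, `St a t` ∋ the image of `[a, t)` under
every present `P`-term, and `B k a c` a budget with (i) `mK+1 ≤ B 0 a c`, (ii) `B k a c ≤ B (k+1) a c` whenever `c − a ≤ 2^k`,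
(iii) `#St(a, a+2^k) · (B k a (a+2^k) + B k (a+2^k) c) ≤ B (k+1) a c` whenever `2^k < c − a ≤ 2^{k+1}`.  Then a column interval
`[a, c)` with `c − a ≤ 2^k` has at most `B k a c` optimal restrictions of `P`-terms with any prescribed image. [folklore] -/
theorem card_optRestr_img_le_budget (P : Equiv.Perm (Fin m) × (Fin m → Fin K) → Prop)
    (St : ℕ → ℕ → Finset (Finset (Fin m)))
    (hSt : ∀ p : Equiv.Perm (Fin m) × (Fin m → Fin K), termSign ε p ≠ 0 → P p → ∀ a t : ℕ, (ico m a t).image p.1 ∈ St a t)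
    (B : ℕ → ℕ → ℕ → ℕ) (hB0 : ∀ a c : ℕ, m * K + 1 ≤ B 0 a c)
    (hBmono : ∀ k a c : ℕ, c - a ≤ 2 ^ k → B k a c ≤ B (k + 1) a c)
    (hBstep : ∀ k a c : ℕ, 2 ^ k < c - a → c - a ≤ 2 ^ (k + 1) →
      (St a (a + 2 ^ k)).card * (B k a (a + 2 ^ k) + B k (a + 2 ^ k) c) ≤ B (k + 1) a c) :
    ∀ (k a c : ℕ) (R : Finset (Fin m)), a ≤ c → c - a ≤ 2 ^ k →
      (optRestr d v ε (ico m a c) (fun p => (ico m a c).image p.1 = R ∧ P p)).card ≤ B k a c := by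
  classical
  intro k
  induction k with
  | zero =>
    intro a c R _ hl
    have hJ : (ico m a c).card ≤ 1 := (card_ico_le a c).trans (by simpa using hl)
    exact (card_optRestr_le_of_card_le_one hJ _).trans (hB0 a c)
  | succ k ih =>
    intro a c R hac hl
    by_cases hsmall : c - a ≤ 2 ^ k
    · exact (ih a c R hac hsmall).trans (hBmono k a c hsmall)
    · set t := a + 2 ^ k with ht
      have hat : a ≤ t := by omega
      have htc : t ≤ c := by
        have : 2 ^ (k + 1) = 2 ^ k + 2 ^ k := by rw [pow_succ]; ring
        omega
      have hl1 : t - a ≤ 2 ^ k := by omega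
      have hl2 : c - t ≤ 2 ^ k := by
        have : 2 ^ (k + 1) = 2 ^ k + 2 ^ k := by rw [pow_succ]; ring
        omega
      have hsplit : ico m a c = ico m a t ∪ ico m t c := ico_union hat htc
      have hcover : optRestr d v ε (ico m a c) (fun p => (ico m a c).image p.1 = R ∧ P p) ⊆
          (St a t).biUnion fun S => optRestr d v ε (ico m a c)
            (fun p => ((ico m a c).image p.1 = R ∧ P p) ∧ (ico m a t).image p.1 = S) := by
        intro r hr
        obtain ⟨p, θ, hq, hopt, rfl⟩ := mem_optRestr.1 hr
        exact Finset.mem_biUnion.2 ⟨(ico m a t).image p.1, hSt p hopt.1 hq.2 a t,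
          mem_optRestr.2 ⟨p, θ, ⟨hq, rfl⟩, hopt, rfl⟩⟩
      have hgroup : ∀ S ∈ St a t, (optRestr d v ε (ico m a c)
          (fun p => ((ico m a c).image p.1 = R ∧ P p) ∧ (ico m a t).image p.1 = S)).card ≤ B k a t + B k t c := by
        intro S _
        rw [hsplit]
        have step := card_optRestr_union_le (d := d) (v := v) (ε := ε) (J₁ := ico m a t) (J₂ := ico m t c)
          (Q := fun p => ((ico m a t ∪ ico m t c).image p.1 = R ∧ P p) ∧ (ico m a t).image p.1 = S)
          (Q₁ := fun p => (ico m a t).image p.1 = S ∧ P p)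
          (Q₂ := fun p => (ico m t c).image p.1 = R \ S ∧ P p)
          (fun p h => ⟨h.2, h.1.2⟩)
          (fun p h => ⟨by rw [image_eq_sdiff_of_union (disjoint_ico_ico a t c) p.1, h.1.1, h.2], h.1.2⟩)
          (fun p p' h h' => by rw [h.1, h'.1])
          (fun p p' h h' => by rw [h.1, h'.1])
        exact step.trans (Nat.add_le_add (ih a t S hat hl1) (ih t c (R \ S) htc hl2))
      calc _ ≤ ((St a t).biUnion fun S => optRestr d v ε (ico m a c)
              (fun p => ((ico m a c).image p.1 = R ∧ P p) ∧ (ico m a t).image p.1 = S)).card :=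
            Finset.card_le_card hcover
        _ ≤ ∑ S ∈ St a t, (optRestr d v ε (ico m a c)
              (fun p => ((ico m a c).image p.1 = R ∧ P p) ∧ (ico m a t).image p.1 = S)).card := Finset.card_biUnion_le
        _ ≤ ∑ _S ∈ St a t, (B k a t + B k t c) := Finset.sum_le_sum hgroup
        _ = (St a t).card * (B k a t + B k t c) := by rw [Finset.sum_const, smul_eq_mul]
        _ ≤ B (k + 1) a c := hBstep k a c (by omega) hl

/-- **chain form**: a dominant chain (distinct consecutive terms) of `P`-terms has `n + 1 ≤ B (⌊log₂ m⌋+1) 0 m` for every budget `B`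
absorbing the recursion with the state families of the `P`-terms. [folklore] -/
theorem chain_le_budget (P : Equiv.Perm (Fin m) × (Fin m → Fin K) → Prop)
    (St : ℕ → ℕ → Finset (Finset (Fin m)))
    (hSt : ∀ p : Equiv.Perm (Fin m) × (Fin m → Fin K), termSign ε p ≠ 0 → P p → ∀ a t : ℕ, (ico m a t).image p.1 ∈ St a t)
    (B : ℕ → ℕ → ℕ → ℕ) (hB0 : ∀ a c : ℕ, m * K + 1 ≤ B 0 a c)
    (hBmono : ∀ k a c : ℕ, c - a ≤ 2 ^ k → B k a c ≤ B (k + 1) a c)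
    (hBstep : ∀ k a c : ℕ, 2 ^ k < c - a → c - a ≤ 2 ^ (k + 1) →
      (St a (a + 2 ^ k)).card * (B k a (a + 2 ^ k) + B k (a + 2 ^ k) c) ≤ B (k + 1) a c)
    {n : ℕ} (θ : Fin (n + 1) → ℤ) (p : Fin (n + 1) → Equiv.Perm (Fin m) × (Fin m → Fin K)) (hθ : StrictMono θ)
    (hdom : ∀ k, IsDominant d v ε (θ k) (p k)) (hne : ∀ k : Fin n, p k.castSucc ≠ p k.succ) (hP : ∀ k, P (p k)) :
    n + 1 ≤ B (Nat.log 2 m + 1) 0 m := by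
  classical
  have hinj := injective_of_chainD d v ε θ p hθ hdom hne
  have h1 := chain_le_card_optRestr (d := d) (v := v) (ε := ε) θ p hinj hdom
    (fun q => (ico m 0 m).image q.1 = ico m 0 m ∧ P q)
    (fun k => ⟨by rw [ico_univ]; exact Finset.image_univ_equiv _, hP k⟩)
  rw [← (ico_univ : ico m 0 m = Finset.univ)] at h1
  have h2 := card_optRestr_img_le_budget (d := d) (v := v) P St hSt B hB0 hBmono hBstep (Nat.log 2 m + 1) 0 m (ico m 0 m)
    (Nat.zero_le _) (by have := Nat.lt_pow_succ_log_self one_lt_two m; omega)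
  exact h1.trans h2

/-- **The visited-image recursion with a node-dependent budget.**  Along ONE dominant chain of any design: if `B` absorbs the
recursion with, at the node `[a, c)` split at `t = a + 2^k`, the factor «number of row images `σ_j([a, t))` the CHAIN visits», then
`n + 1 ≤ B (⌊log₂ m⌋+1) 0 m`.  (Unrolled: `n + 1 ≤ (mK+1) · Σ_{leaves} Π_{nodes above the leaf} #visited images of the node's first
half` — the per-path product; the uniform `(2V)^{⌊log₂ m⌋+1}` of `chain_le_of_visitedImages` is the special case `B k _ _ = (mK+1)(2V)^k`.)
[folklore] -/
theorem chain_le_visitedBudget {n : ℕ} (θ : Fin (n + 1) → ℤ) (p : Fin (n + 1) → Equiv.Perm (Fin m) × (Fin m → Fin K))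
    (hθ : StrictMono θ) (hdom : ∀ k, IsDominant d v ε (θ k) (p k)) (hne : ∀ k : Fin n, p k.castSucc ≠ p k.succ)
    (B : ℕ → ℕ → ℕ → ℕ) (hB0 : ∀ a c : ℕ, m * K + 1 ≤ B 0 a c)
    (hBmono : ∀ k a c : ℕ, c - a ≤ 2 ^ k → B k a c ≤ B (k + 1) a c)
    (hBstep : ∀ k a c : ℕ, 2 ^ k < c - a → c - a ≤ 2 ^ (k + 1) →
      ((Finset.univ : Finset (Fin (n + 1))).image fun j => (ico m a (a + 2 ^ k)).image (p j).1).card *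
        (B k a (a + 2 ^ k) + B k (a + 2 ^ k) c) ≤ B (k + 1) a c) :
    n + 1 ≤ B (Nat.log 2 m + 1) 0 m := by
  classical
  exact chain_le_budget (d := d) (v := v) (ε := ε) (fun q => ∃ j, p j = q)
    (fun a t => (Finset.univ : Finset (Fin (n + 1))).image fun j => (ico m a t).image (p j).1)
    (fun q _ hq a t => by
      obtain ⟨j, rfl⟩ := hq
      exact Finset.mem_image.2 ⟨j, Finset.mem_univ _, rfl⟩)
    B hB0 hBmono hBstep θ p hθ hdom hne (fun j => ⟨j, rfl⟩)

end IntervalOpt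

end Summit.ValiantsHypothesis.ValiantsHypothesis.Theorems.KPlusLogSqLaw
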